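import Summits.CriticalPhenomena.PercolationContinuityZ3.Theorems.PercNearOneGluingAdditiveGluingPairStepOdds

/-! # Crux `PercNearOneGluing.AdditiveGluing` (stmt-CriticalPhenomena-4576), line `peel`, stub `stub_ratioMonotonePair` —
# the pair step at ONE relay, part 2: the stub in its exact syntax for `A = {b, a₀}`

Support file (`--supports stmt-CriticalPhenomena-4576`); no definitions, no named facts.  Theorems-side copy of the last part of
the crux workfile `Cruxes/AdditiveGluing/RatioOneRelay.lean` (control-strategist seat g2, sorry-free; names `ratioOneRelay_*` ↦
`pairStep_*`, `ratioMonotonePair_oneRelay` ↦ `pairStep_oneRelay`).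

* `pairStep_inf'_pair`: for a pocket `W` avoiding `{b, a₀}` the worst selection is `a₀` (the `b`-term is `1`);
* `pairStep_blockPockets_eq` / `pairStep_pointPockets_eq`: at one relay the dead-pocket masses (block / point, `Finset.inf'`
  product form) are the losing masses `μ(a₀ ↔ b, · ↮ b, · ↮ a₀)` (pocket Markov property);
* `pairStep_oneRelay`: the stub `stub_ratioMonotonePair` for `A = {b, a₀}` — `K(s)·Z(S) ≤ K(S)·Z(s)`, by `pairStep_odds`.
* `stub_ratioOneRelay` (appended 2026-08-17, skeleton-register seat): the same, as the REGISTERED rung of line `peel`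
  (closed statement, registered name + signature verbatim) — credits the one-relay rung to the skeleton.
[cite: KozmaNitzan2024, §3.2 pp. 12–14; VandenbergHaggstromKahn2005, Thm. 1.3 (p. 6), Thm. 1.4 (p. 7)]
-/

namespace Summit.CriticalPhenomena.PercolationContinuityZ3.Theorems

open MeasureTheory Set
open Literature.Probability.LatticeModels (prodBernoulli)
open Literature.Probability.Percolation

noncomputable section
open Classical

section PairStepOneRelay

variable {n : ℕ}

/-- For a pocket `W` avoiding `{b, a₀}` the worst selection over `{b, a₀}` is `a₀`:
`inf'_{a ∈ {b,a₀}} μ(a ↔ b in Wᶜ) = μ(a₀ ↔ b in Wᶜ)` (the `b`-term is `1`). [folklore] -/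
theorem pairStep_inf'_pair (u : Sym2 (Fin n) → unitInterval) (b a₀ : Fin n) (W : Finset (Fin n))
    (hW : Disjoint W ({b, a₀} : Finset (Fin n))) (hb : b ∈ ({b, a₀} : Finset (Fin n))) :
    ({b, a₀} : Finset (Fin n)).inf' ⟨b, hb⟩
        (fun a => (prodBernoulli u).real (openConnIn ((W : Set (Fin n)))ᶜ a b)) =
      (prodBernoulli u).real (openConnIn ((W : Set (Fin n)))ᶜ a₀ b) := by
  have hbW : b ∉ W := fun h => Finset.disjoint_left.1 hW h (Finset.mem_insert_self b _)
  have hbb : (prodBernoulli u).real (openConnIn ((W : Set (Fin n)))ᶜ b b) = 1 := by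
    have huniv : (openConnIn ((W : Set (Fin n)))ᶜ b b : Set (BondConfig (Fin n))) = Set.univ := by
      refine Set.eq_univ_of_forall fun ω => ?_
      have hbc : b ∈ ((W : Set (Fin n)))ᶜ := fun h => hbW (Finset.mem_coe.1 h)
      exact ⟨hbc, hbc, SimpleGraph.Reachable.refl _⟩
    rw [huniv, probReal_univ]
  refine le_antisymm (Finset.inf'_le _ (by simp)) (Finset.le_inf' _ _ fun a ha => ?_)
  rcases Finset.mem_insert.1 ha with rfl | ha'
  · rw [hbb]
    exact measureReal_le_one
  · rw [Finset.mem_singleton.1 ha']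

/-- The block's dead-pocket mass at one relay is the losing mass:
`Σ_{W ∩ {b,a₀} = ∅} μ(K_S = W) · inf' = μ(a₀ ↔ b, S ↮ b, S ↮ a₀)`. [folklore; KozmaNitzan2024 §3.2 p. 14 (pocket Markov)] -/
theorem pairStep_blockPockets_eq (u : Sym2 (Fin n) → unitInterval) (S : Finset (Fin n)) (hS : S.Nonempty)
    (b a₀ : Fin n) (hb : b ∈ ({b, a₀} : Finset (Fin n))) :
    ∑ W ∈ (Finset.univ : Finset (Finset (Fin n))).filter (fun W => Disjoint W ({b, a₀} : Finset (Fin n))),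
        (prodBernoulli u).real {ω : BondConfig (Fin n) | ∀ z : Fin n, (z ∈ W ↔ ω ∈ ⋃ x ∈ S, openConn x z)}
          * ({b, a₀} : Finset (Fin n)).inf' ⟨b, hb⟩
              (fun a => (prodBernoulli u).real (openConnIn ((W : Set (Fin n)))ᶜ a b)) =
      (prodBernoulli u).real (openConn a₀ b ∩
        {ω : BondConfig (Fin n) | ∀ a ∈ ({b, a₀} : Finset (Fin n)), ω ∉ ⋃ x ∈ S, openConn x a}) := by
  rw [← blockPocket_sum_dead u S {b, a₀} (openConn a₀ b)]
  refine Finset.sum_congr rfl fun W hW => ?_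
  have hWd : Disjoint W ({b, a₀} : Finset (Fin n)) := (Finset.mem_filter.1 hW).2
  have ha₀W : a₀ ∉ W := fun h => Finset.disjoint_left.1 hWd h (by simp)
  rw [pairStep_inf'_pair u b a₀ W hWd hb, blockPocket_mul_offConn u S W hS a₀ b ha₀W]

/-- The point's dead-pocket mass at one relay is the losing mass:
`Σ_{W ∋ s, W ∩ {b,a₀} = ∅} μ(C(s) = W) · inf' = μ(a₀ ↔ b, s ↮ b, s ↮ a₀)`. [folklore; KozmaNitzan2024 §3.2 p. 14] -/
theorem pairStep_pointPockets_eq (u : Sym2 (Fin n) → unitInterval) (s b a₀ : Fin n)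
    (hsb : s ≠ b) (hsa : s ≠ a₀) (hb : b ∈ ({b, a₀} : Finset (Fin n))) :
    ∑ W ∈ (Finset.univ : Finset (Finset (Fin n))).filter (fun W => s ∈ W ∧ Disjoint W ({b, a₀} : Finset (Fin n))),
        (prodBernoulli u).real {ω : BondConfig (Fin n) | openCluster ω s = (W : Set (Fin n))}
          * ({b, a₀} : Finset (Fin n)).inf' ⟨b, hb⟩
              (fun a => (prodBernoulli u).real (openConnIn ((W : Set (Fin n)))ᶜ a b)) =
      (prodBernoulli u).real (openConn a₀ b ∩ (openConn s b)ᶜ ∩ (openConn s a₀)ᶜ) := by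
  rw [← offObs_sum_fib_inter u s (openConn a₀ b ∩ (openConn s b)ᶜ ∩ (openConn s a₀)ᶜ), Finset.sum_filter]
  refine Finset.sum_congr rfl fun W _ => ?_
  by_cases hW : s ∈ W ∧ Disjoint W ({b, a₀} : Finset (Fin n))
  · rw [if_pos hW]
    have hbW : b ∉ W := fun h => Finset.disjoint_left.1 hW.2 h (Finset.mem_insert_self b _)
    have ha₀W : a₀ ∉ W := fun h => Finset.disjoint_left.1 hW.2 h (by simp)
    rw [pairStep_inf'_pair u b a₀ W hW.2 hb, ← stub_goodStep_var1359 n u W s a₀ b hW.1 ha₀W hbW]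
    congr 1
    ext ω
    simp only [Set.mem_inter_iff, Set.mem_setOf_eq, Set.mem_compl_iff]
    constructor
    · rintro ⟨hC, hab⟩
      refine ⟨hC, ⟨hab, fun hsb' => hbW ?_⟩, fun hsa' => ha₀W ?_⟩
      · exact Finset.mem_coe.1 (hC ▸ (show b ∈ openCluster ω s from hsb'))
      · exact Finset.mem_coe.1 (hC ▸ (show a₀ ∈ openCluster ω s from hsa'))
    · rintro ⟨hC, ⟨hab, -⟩, -⟩
      exact ⟨hC, hab⟩
  · rw [if_neg hW]
    symm
    -- the fibre meets the event only for admissible `W`: the intersection is empty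
    have hempty : {ω : BondConfig (Fin n) | openCluster ω s = (W : Set (Fin n))} ∩
        (openConn a₀ b ∩ (openConn s b)ᶜ ∩ (openConn s a₀)ᶜ) = ∅ := by
      ext ω
      simp only [Set.mem_inter_iff, Set.mem_setOf_eq, Set.mem_compl_iff, Set.mem_empty_iff_false, iff_false,
        not_and, not_not]
      intro hC hab
      by_contra hsa'
      apply hW
      refine ⟨?_, Finset.disjoint_left.2 fun z hz hzA => ?_⟩
      · rw [← Finset.mem_coe, ← hC]
        exact (SimpleGraph.Reachable.refl s : (openGraph ω).Reachable s s)
      · have hz' : z ∈ openCluster ω s := by rw [hC]; exact Finset.mem_coe.2 hz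
        rcases Finset.mem_insert.1 hzA with rfl | hz2
        · exact hab.2 hz'
        · rw [Finset.mem_singleton] at hz2
          subst hz2
          exact hsa' hz'
    rw [hempty, measureReal_empty]

/-- **The line's stub `stub_ratioMonotonePair` at ONE relay**, in its exact syntax: for `A = {b, a₀}`, a 2-block `S ∋ s`
disjoint from `A`, `K(s)·Z(S) ≤ K(S)·Z(s)` — no minimiser or badness hypothesis is needed at one relay.  Proof: the dead-pocket
masses are the losing masses (`pairStep_pointPockets_eq`, `pairStep_blockPockets_eq`), the slacks are the winning masses
(event bookkeeping), and the inequality is `pairStep_odds`.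
[cite: KozmaNitzan2024, §3.2 pp. 12–14; VandenbergHaggstromKahn2005, Thms. 1.3–1.4 (pp. 6–7)] -/
theorem pairStep_oneRelay (u : Sym2 (Fin n) → unitInterval) (S : Finset (Fin n)) (b a₀ s : Fin n)
    (hb : b ∈ ({b, a₀} : Finset (Fin n))) (hSA : Disjoint S ({b, a₀} : Finset (Fin n)))
    (hs : s ∈ S) (h2 : S.card = 2) :
    ((prodBernoulli u).real (openConn s b)
        + (∑ W ∈ (Finset.univ : Finset (Finset (Fin n))).filter
              (fun W => s ∈ W ∧ Disjoint W ({b, a₀} : Finset (Fin n))),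
            (prodBernoulli u).real {ω : BondConfig (Fin n) | openCluster ω s = (W : Set (Fin n))}
              * ({b, a₀} : Finset (Fin n)).inf' ⟨b, hb⟩
                  (fun a => (prodBernoulli u).real (openConnIn ((W : Set (Fin n)))ᶜ a b)))
        - (prodBernoulli u).real (openConn a₀ b))
      * (∑ W ∈ (Finset.univ : Finset (Finset (Fin n))).filter (fun W => Disjoint W ({b, a₀} : Finset (Fin n))),
            (prodBernoulli u).real
                {ω : BondConfig (Fin n) | ∀ z : Fin n, (z ∈ W ↔ ω ∈ ⋃ v ∈ S, openConn v z)}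
              * ({b, a₀} : Finset (Fin n)).inf' ⟨b, hb⟩
                  (fun a => (prodBernoulli u).real (openConnIn ((W : Set (Fin n)))ᶜ a b)))
    ≤ ((prodBernoulli u).real (⋃ v ∈ S, openConn v b)
        + (∑ W ∈ (Finset.univ : Finset (Finset (Fin n))).filter (fun W => Disjoint W ({b, a₀} : Finset (Fin n))),
            (prodBernoulli u).real
                {ω : BondConfig (Fin n) | ∀ z : Fin n, (z ∈ W ↔ ω ∈ ⋃ v ∈ S, openConn v z)}
              * ({b, a₀} : Finset (Fin n)).inf' ⟨b, hb⟩
                  (fun a => (prodBernoulli u).real (openConnIn ((W : Set (Fin n)))ᶜ a b)))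
        - (prodBernoulli u).real (openConn a₀ b)
        - (prodBernoulli u).real
            ((openConn a₀ b)ᶜ ∩ (⋃ v ∈ S, openConn a₀ v) ∩ (⋃ v ∈ S, openConn v b)))
      * (∑ W ∈ (Finset.univ : Finset (Finset (Fin n))).filter
            (fun W => s ∈ W ∧ Disjoint W ({b, a₀} : Finset (Fin n))),
          (prodBernoulli u).real {ω : BondConfig (Fin n) | openCluster ω s = (W : Set (Fin n))}
            * ({b, a₀} : Finset (Fin n)).inf' ⟨b, hb⟩
                (fun a => (prodBernoulli u).real (openConnIn ((W : Set (Fin n)))ᶜ a b))) := by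
  -- the block is `{s, v}`
  obtain ⟨v, hvs, rfl⟩ : ∃ v : Fin n, v ≠ s ∧ S = {s, v} := by
    obtain ⟨x, y, hxy, rfl⟩ := Finset.card_eq_two.1 h2
    rcases Finset.mem_insert.1 hs with rfl | hsy
    · exact ⟨y, Ne.symm hxy, rfl⟩
    · rw [Finset.mem_singleton] at hsy
      subst hsy
      exact ⟨x, hxy, Finset.pair_comm x s⟩
  have hsb : s ≠ b := fun h => Finset.disjoint_left.1 hSA hs (by simp [h])
  have hsa : s ≠ a₀ := fun h => Finset.disjoint_left.1 hSA hs (by simp [h])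
  have hvb : v ≠ b := fun h => Finset.disjoint_left.1 hSA (by simp : v ∈ ({s, v} : Finset (Fin n))) (by simp [h])
  have hva : v ≠ a₀ := fun h => Finset.disjoint_left.1 hSA (by simp : v ∈ ({s, v} : Finset (Fin n))) (by simp [h])
  -- pockets = losing masses
  rw [pairStep_pointPockets_eq u s b a₀ hsb hsa hb,
    pairStep_blockPockets_eq u {s, v} ⟨s, Finset.mem_insert_self s _⟩ b a₀ hb]
  -- the unions over the block
  have hU : (⋃ x ∈ ({s, v} : Finset (Fin n)), (openConn x b : Set (BondConfig (Fin n)))) = openConn s b ∪ openConn v b := by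
    rw [Finset.set_biUnion_insert, Finset.set_biUnion_singleton]
  have hX : (⋃ x ∈ ({s, v} : Finset (Fin n)), (openConn a₀ x : Set (BondConfig (Fin n)))) = openConn a₀ s ∪ openConn a₀ v := by
    rw [Finset.set_biUnion_insert, Finset.set_biUnion_singleton]
  rw [hU, hX]
  -- the two losing events, simplified
  have hLpt : (openConn a₀ b : Set (BondConfig (Fin n))) ∩ (openConn s b)ᶜ ∩ (openConn s a₀)ᶜ =
      openConn a₀ b ∩ (openConn s b)ᶜ := by
    ext ω
    simp only [Set.mem_inter_iff, Set.mem_compl_iff]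
    constructor
    · rintro ⟨⟨hab, hsb'⟩, -⟩; exact ⟨hab, hsb'⟩
    · rintro ⟨hab, hsb'⟩
      exact ⟨⟨hab, hsb'⟩, fun hsa' => hsb' ((show (openGraph ω).Reachable s a₀ from hsa').trans hab)⟩
  have hLblk : (openConn a₀ b : Set (BondConfig (Fin n))) ∩
      {ω : BondConfig (Fin n) | ∀ a ∈ ({b, a₀} : Finset (Fin n)), ω ∉ ⋃ x ∈ ({s, v} : Finset (Fin n)), openConn x a} =
      openConn a₀ b ∩ (openConn s b)ᶜ ∩ (openConn v b)ᶜ := by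
    ext ω
    simp only [Set.mem_inter_iff, Set.mem_compl_iff, Set.mem_setOf_eq, Finset.mem_insert, Finset.mem_singleton,
      Set.mem_iUnion, exists_prop, not_exists, not_and, forall_eq_or_imp, forall_eq]
    constructor
    · rintro ⟨hab, ⟨hsb', hvb'⟩, -⟩
      exact ⟨⟨hab, hsb'⟩, hvb'⟩
    · rintro ⟨⟨hab, hsb'⟩, hvb'⟩
      exact ⟨hab, ⟨hsb', hvb'⟩,
        ⟨fun hsa' => hsb' ((show (openGraph ω).Reachable s a₀ from hsa').trans hab),
         fun hva' => hvb' ((show (openGraph ω).Reachable v a₀ from hva').trans hab)⟩⟩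
  rw [hLpt, hLblk]
  -- names
  set μ' := prodBernoulli u with hμ'
  set Psb := μ'.real (openConn s b) with hPsb
  set Pab := μ'.real (openConn a₀ b) with hPab
  set Lpt := μ'.real (openConn a₀ b ∩ (openConn s b)ᶜ) with hLptd
  set Lblk := μ'.real (openConn a₀ b ∩ (openConn s b)ᶜ ∩ (openConn v b)ᶜ) with hLblkd
  set PU := μ'.real (openConn s b ∪ openConn v b) with hPU
  set G := μ'.real ((openConn a₀ b)ᶜ ∩ (openConn a₀ s ∪ openConn a₀ v) ∩ (openConn s b ∪ openConn v b)) with hG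
  set Wpt := μ'.real (openConn s b ∩ (openConn a₀ s)ᶜ) with hWpt
  set Wblk := μ'.real ((openConn s b ∪ openConn v b) ∩ (openConn a₀ s)ᶜ ∩ (openConn a₀ v)ᶜ) with hWblk
  -- K(s) = WIN(s)
  have hKpt : Psb + Lpt - Pab = Wpt := by
    have h1 := measureReal_inter_add_sdiff (μ := μ') (s := (openConn a₀ b : Set (BondConfig (Fin n))))
      (MeasurableSet.of_discrete (s := (openConn s b : Set (BondConfig (Fin n)))))
    have h2 := measureReal_inter_add_sdiff (μ := μ') (s := (openConn s b : Set (BondConfig (Fin n))))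
      (MeasurableSet.of_discrete (s := (openConn a₀ b : Set (BondConfig (Fin n)))))
    have e1 : (openConn a₀ b : Set (BondConfig (Fin n))) \ openConn s b = openConn a₀ b ∩ (openConn s b)ᶜ := rfl
    have e2 : (openConn s b : Set (BondConfig (Fin n))) \ openConn a₀ b = openConn s b ∩ (openConn a₀ s)ᶜ := by
      ext ω
      simp only [Set.mem_sdiff, Set.mem_inter_iff, Set.mem_compl_iff]
      constructor
      · rintro ⟨hsb', hab⟩
        exact ⟨hsb', fun has' => hab ((show (openGraph ω).Reachable a₀ s from has').trans hsb')⟩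
      · rintro ⟨hsb', has'⟩
        exact ⟨hsb', fun hab => has' ((show (openGraph ω).Reachable a₀ b from hab).trans
          (SimpleGraph.Reachable.symm hsb'))⟩
    have e3 : (openConn s b : Set (BondConfig (Fin n))) ∩ openConn a₀ b = openConn a₀ b ∩ openConn s b := Set.inter_comm _ _
    rw [e1] at h1
    rw [e2, e3] at h2
    linarith
  -- K(S) = WIN(S)
  have hKblk : PU + Lblk - Pab - G = Wblk := by
    have h1 := measureReal_inter_add_sdiff (μ := μ') (s := (openConn a₀ b : Set (BondConfig (Fin n))))
      (MeasurableSet.of_discrete (s := (openConn s b ∪ openConn v b : Set (BondConfig (Fin n)))))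
    have h2 := measureReal_inter_add_sdiff (μ := μ') (s := (openConn s b ∪ openConn v b : Set (BondConfig (Fin n))))
      (MeasurableSet.of_discrete (s := (openConn a₀ b : Set (BondConfig (Fin n)))))
    have h3 := measureReal_inter_add_sdiff (μ := μ')
      (s := ((openConn s b ∪ openConn v b : Set (BondConfig (Fin n))) \ openConn a₀ b))
      (MeasurableSet.of_discrete (s := (openConn a₀ s ∪ openConn a₀ v : Set (BondConfig (Fin n)))))
    have e1 : (openConn a₀ b : Set (BondConfig (Fin n))) \ (openConn s b ∪ openConn v b) =
        openConn a₀ b ∩ (openConn s b)ᶜ ∩ (openConn v b)ᶜ := by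
      rw [Set.sdiff_eq, Set.compl_union, Set.inter_assoc]
    have e2 : (openConn s b ∪ openConn v b : Set (BondConfig (Fin n))) ∩ openConn a₀ b =
        openConn a₀ b ∩ (openConn s b ∪ openConn v b) := Set.inter_comm _ _
    have e3 : ((openConn s b ∪ openConn v b : Set (BondConfig (Fin n))) \ openConn a₀ b) ∩ (openConn a₀ s ∪ openConn a₀ v) =
        (openConn a₀ b)ᶜ ∩ (openConn a₀ s ∪ openConn a₀ v) ∩ (openConn s b ∪ openConn v b) := by
      ext ω
      simp only [Set.mem_inter_iff, Set.mem_sdiff, Set.mem_compl_iff]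
      tauto
    have e4 : ((openConn s b ∪ openConn v b : Set (BondConfig (Fin n))) \ openConn a₀ b) \ (openConn a₀ s ∪ openConn a₀ v) =
        (openConn s b ∪ openConn v b) ∩ (openConn a₀ s)ᶜ ∩ (openConn a₀ v)ᶜ := by
      ext ω
      simp only [Set.mem_inter_iff, Set.mem_sdiff, Set.mem_compl_iff, Set.mem_union, not_or]
      constructor
      · rintro ⟨⟨hU', -⟩, has', hav'⟩
        exact ⟨⟨hU', has'⟩, hav'⟩
      · rintro ⟨⟨hU', has'⟩, hav'⟩
        refine ⟨⟨hU', fun hab => ?_⟩, has', hav'⟩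
        rcases hU' with hsb' | hvb'
        · exact has' (hab.trans (SimpleGraph.Reachable.symm hsb'))
        · exact hav' (hab.trans (SimpleGraph.Reachable.symm hvb'))
    rw [e1] at h1
    rw [e2] at h2
    rw [e3, e4] at h3
    linarith
  rw [hKpt, hKblk]
  have hodds := pairStep_odds u a₀ s v b (Ne.symm hsa)
  rw [← hμ'] at hodds
  -- `hodds : Wpt * Lblk ≤ Wblk * Lpt` up to the names
  exact hodds

/-- **Registered form** (`stub_pairStepOneRelay_v22786`, `--supports stmt-CriticalPhenomena-4576`): the stub
`stub_ratioMonotonePair` at one relay (`A = {b, a₀}`) as a closed statement. [cite: KozmaNitzan2024, §3.2 pp. 12–14] -/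
theorem stub_pairStepOneRelay_v22786 : ∀ (n : ℕ) (u : Sym2 (Fin n) → unitInterval) (S : Finset (Fin n)) (b a₀ s : Fin n) (hb : b ∈ ({b, a₀} : Finset (Fin n))), Disjoint S ({b, a₀} : Finset (Fin n)) → s ∈ S → S.card = 2 → ((Literature.Probability.LatticeModels.prodBernoulli u).real (Literature.Probability.Percolation.openConn s b) + (∑ W ∈ (Finset.univ : Finset (Finset (Fin n))).filter (fun W => s ∈ W ∧ Disjoint W ({b, a₀} : Finset (Fin n))), (Literature.Probability.LatticeModels.prodBernoulli u).real {ω : Literature.Probability.Percolation.BondConfig (Fin n) | Literature.Probability.Percolation.openCluster ω s = (W : Set (Fin n))} * ({b, a₀} : Finset (Fin n)).inf' ⟨b, hb⟩ (fun a => (Literature.Probability.LatticeModels.prodBernoulli u).real (Literature.Probability.Percolation.openConnIn ((W : Set (Fin n))ᶜ) a b))) - (Literature.Probability.LatticeModels.prodBernoulli u).real (Literature.Probability.Percolation.openConn a₀ b)) * (∑ W ∈ (Finset.univ : Finset (Finset (Fin n))).filter (fun W => Disjoint W ({b, a₀} : Finset (Fin n))), (Literature.Probability.LatticeModels.prodBernoulli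 u).real {ω : Literature.Probability.Percolation.BondConfig (Fin n) | ∀ z : Fin n, (z ∈ W ↔ ω ∈ ⋃ v ∈ S, Literature.Probability.Percolation.openConn v z)} * ({b, a₀} : Finset (Fin n)).inf' ⟨b, hb⟩ (fun a => (Literature.Probability.LatticeModels.prodBernoulli u).real (Literature.Probability.Percolation.openConnIn ((W : Set (Fin n))ᶜ) a b))) ≤ ((Literature.Probability.LatticeModels.prodBernoulli u).real (⋃ v ∈ S, Literature.Probability.Percolation.openConn v b) + (∑ W ∈ (Finset.univ : Finset (Finset (Fin n))).filter (fun W => Disjoint W ({b, a₀} : Finset (Fin n))), (Literature.Probability.LatticeModels.prodBernoulli u).real {ω : Literature.Probability.Percolation.BondConfig (Fin n) | ∀ z : Fin n, (z ∈ W ↔ ω ∈ ⋃ v ∈ S, Literature.Probability.Percolation.openConn v z)} * ({b, a₀} : Finset (Fin n)).inf' ⟨b, hb⟩ (fun a => (Literature.Probability.LatticeModels.prodBernoulli u).real (Literature.Probability.Percolation.openConnIn ((W : Set (Fin n))ᶜ) a b))) - (Literature.Probability.LatticeModels.prodBernoulli u).real (Literature.Probability.Percolation.openConn a₀ b) - (Literature.Probability.LatticeModels.prodBernoulli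 u).real ((Literature.Probability.Percolation.openConn a₀ b)ᶜ ∩ (⋃ v ∈ S, Literature.Probability.Percolation.openConn a₀ v) ∩ (⋃ v ∈ S, Literature.Probability.Percolation.openConn v b))) * (∑ W ∈ (Finset.univ : Finset (Finset (Fin n))).filter (fun W => s ∈ W ∧ Disjoint W ({b, a₀} : Finset (Fin n))), (Literature.Probability.LatticeModels.prodBernoulli u).real {ω : Literature.Probability.Percolation.BondConfig (Fin n) | Literature.Probability.Percolation.openCluster ω s = (W : Set (Fin n))} * ({b, a₀} : Finset (Fin n)).inf' ⟨b, hb⟩ (fun a => (Literature.Probability.LatticeModels.prodBernoulli u).real (Literature.Probability.Percolation.openConnIn ((W : Set (Fin n))ᶜ) a b))) :=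
  fun _ u S b a₀ s hb hSA hs h2 => pairStep_oneRelay u S b a₀ s hb hSA hs h2

/-- **Registered rung `stub_ratioOneRelay` of line `peel`** (crux `AdditiveGluing`, stmt-CriticalPhenomena-4576; registered
2026-08-17 with exactly this name + signature): the pair step at ONE relay — `pairStep_oneRelay` with `n` closed universally and
the binders named.  Lands the one-relay rung of the skeleton's STUB 1 `stub_ratioMonotonePair` under its registered name so that
the stub registry credits it. [cite: KozmaNitzan2024, §3.2 pp. 12–14; VandenbergHaggstromKahn2005, Thm. 1.3 (p. 6), Thm. 1.4 (p. 7)] -/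
theorem stub_ratioOneRelay :
    ∀ (n : ℕ) (u : Sym2 (Fin n) → unitInterval) (S : Finset (Fin n)) (b a₀ s : Fin n)
      (hb : b ∈ ({b, a₀} : Finset (Fin n))) (hSA : Disjoint S ({b, a₀} : Finset (Fin n)))
      (hs : s ∈ S) (h2 : S.card = 2),
    ((prodBernoulli u).real (openConn s b)
        + (∑ W ∈ (Finset.univ : Finset (Finset (Fin n))).filter
              (fun W => s ∈ W ∧ Disjoint W ({b, a₀} : Finset (Fin n))),
            (prodBernoulli u).real {ω : BondConfig (Fin n) | openCluster ω s = (W : Set (Fin n))}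
              * ({b, a₀} : Finset (Fin n)).inf' ⟨b, hb⟩
                  (fun a => (prodBernoulli u).real (openConnIn ((W : Set (Fin n)))ᶜ a b)))
        - (prodBernoulli u).real (openConn a₀ b))
      * (∑ W ∈ (Finset.univ : Finset (Finset (Fin n))).filter (fun W => Disjoint W ({b, a₀} : Finset (Fin n))),
            (prodBernoulli u).real
                {ω : BondConfig (Fin n) | ∀ z : Fin n, (z ∈ W ↔ ω ∈ ⋃ v ∈ S, openConn v z)}
              * ({b, a₀} : Finset (Fin n)).inf' ⟨b, hb⟩
                  (fun a => (prodBernoulli u).real (openConnIn ((W : Set (Fin n)))ᶜ a b)))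
    ≤ ((prodBernoulli u).real (⋃ v ∈ S, openConn v b)
        + (∑ W ∈ (Finset.univ : Finset (Finset (Fin n))).filter (fun W => Disjoint W ({b, a₀} : Finset (Fin n))),
            (prodBernoulli u).real
                {ω : BondConfig (Fin n) | ∀ z : Fin n, (z ∈ W ↔ ω ∈ ⋃ v ∈ S, openConn v z)}
              * ({b, a₀} : Finset (Fin n)).inf' ⟨b, hb⟩
                  (fun a => (prodBernoulli u).real (openConnIn ((W : Set (Fin n)))ᶜ a b)))
        - (prodBernoulli u).real (openConn a₀ b)
        - (prodBernoulli u).real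
            ((openConn a₀ b)ᶜ ∩ (⋃ v ∈ S, openConn a₀ v) ∩ (⋃ v ∈ S, openConn v b)))
      * (∑ W ∈ (Finset.univ : Finset (Finset (Fin n))).filter
            (fun W => s ∈ W ∧ Disjoint W ({b, a₀} : Finset (Fin n))),
          (prodBernoulli u).real {ω : BondConfig (Fin n) | openCluster ω s = (W : Set (Fin n))}
            * ({b, a₀} : Finset (Fin n)).inf' ⟨b, hb⟩
                (fun a => (prodBernoulli u).real (openConnIn ((W : Set (Fin n)))ᶜ a b))) :=
  fun _ u S b a₀ s hb hSA hs h2 => pairStep_oneRelay u S b a₀ s hb hSA hs h2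

end PairStepOneRelay

end

end Summit.CriticalPhenomena.PercolationContinuityZ3.Theorems
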